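import Summits.Schanuel.Schanuel.Theorems.RootDecomp1DFlagSplit

/-!
# RootDecomp1D — round-4 glue: `T → Λ → D → SchanuelOverSecondExpFields` (lens-3 gen 4, NODE v5 «EL flag»)

Proves the D-0019 glue item `SchanuelOverSecondExpFieldsGlue` (stmt-Schanuel-28395) of the split of
`SchanuelOverSecondExpFields` (stmt-Schanuel-27659) into `IteratedExpOverSecondExpFields` (T, 28392),
`ExpLogOverExpTowerFields` (Λ, 28393) and `SchanuelOverExpLogFields` (D, 28394): two applications of the
in-tree transitivity `relOn_trans` (engine E1 = defect additivity along a flag,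
`Theorems/RootDecomp1DFlagSplit.lean`) along `𝓔 ≤ 𝓔∞ ≤ 𝓜 ≤ ⊤`, plus the two inclusions of the literal tower
spans (`𝓔 = 𝓔₁ ≤ 𝓔∞` and `𝓔 ≤ 𝓜₁ ≤ 𝓜`).  No transcendence input; this file defines nothing.
Port of the lens-3 hand-off `HOME/decomp-schanuel-lens-3/v5/prover/RootDecomp1DSecondExpSplit.port.lean`
(critic CLEARED the node 2026-08-30T05:12:46Z, route rev 8–10 typed 05:21:59Z) by the census seat; 0 sorry.
-/

set_option linter.dupNamespace false

noncomputable section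

namespace Summit.Schanuel.Schanuel.Theorems.RootDecomp1DSecondExpSplit

open Summit.Schanuel.Schanuel.Theses.RootDecomp1D
open Summit.Schanuel.Schanuel.Theorems.RootDecomp1DFlagSplit (relOn_trans)

/-- `𝓔 = 𝓔₁ ≤ 𝓔∞`: the second-exponential span is the first level of the E-tower. -/
theorem secondExp_le_expTowerSup :
    Submodule.span ℚ (({z : ℂ | IsAlgebraic ℚ z} ∪ {z : ℂ | ∃ β l : ℂ, IsAlgebraic ℚ β ∧ IsAlgebraic ℚ (Complex.exp l) ∧ z = β * l}) ∪ Complex.exp '' ↑(Submodule.span ℚ ({z : ℂ | IsAlgebraic ℚ z} ∪ {z : ℂ | ∃ β l : ℂ, IsAlgebraic ℚ β ∧ IsAlgebraic ℚ (Complex.exp l) ∧ z = β * l}))) ≤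
      ⨆ n : ℕ, (fun E : Submodule ℚ ℂ => E ⊔ Submodule.span ℚ (Complex.exp '' ↑E))^[n + 1] (Submodule.span ℚ ({z : ℂ | IsAlgebraic ℚ z} ∪ {z : ℂ | ∃ β l : ℂ, IsAlgebraic ℚ β ∧ IsAlgebraic ℚ (Complex.exp l) ∧ z = β * l})) := by
  refine le_trans (le_of_eq ?_) (le_iSup_of_le 0 le_rfl)
  simp only [zero_add, Function.iterate_one]
  exact Submodule.span_union _ _

/-- `𝓔 ≤ 𝓜₁ ≤ 𝓜`: the second-exponential span sits inside the first level of the EL-tower. -/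
theorem secondExp_le_elSpan :
    Submodule.span ℚ (({z : ℂ | IsAlgebraic ℚ z} ∪ {z : ℂ | ∃ β l : ℂ, IsAlgebraic ℚ β ∧ IsAlgebraic ℚ (Complex.exp l) ∧ z = β * l}) ∪ Complex.exp '' ↑(Submodule.span ℚ ({z : ℂ | IsAlgebraic ℚ z} ∪ {z : ℂ | ∃ β l : ℂ, IsAlgebraic ℚ β ∧ IsAlgebraic ℚ (Complex.exp l) ∧ z = β * l}))) ≤
      ⨆ n : ℕ, (fun E : Submodule ℚ ℂ => (E ⊔ Submodule.span ℚ (Complex.exp '' ↑E)) ⊔ Submodule.span ℚ (Complex.exp ⁻¹' ↑(E ⊔ Submodule.span ℚ (Complex.exp '' ↑E))))^[n + 1] (Submodule.span ℚ ({z : ℂ | IsAlgebraic ℚ z} ∪ {z : ℂ | ∃ β l : ℂ, IsAlgebraic ℚ β ∧ IsAlgebraic ℚ (Complex.exp l) ∧ z = β * l})) := by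
  refine le_trans ?_ (le_iSup_of_le 0 le_rfl)
  simp only [zero_add, Function.iterate_one]
  rw [Submodule.span_union]
  exact le_sup_left

/-- Item stmt-Schanuel-28395 (glue of the split of `SchanuelOverSecondExpFields`, stmt-Schanuel-27659):
`T → Λ → D → P6`, transitivity (E1) along `𝓔 ≤ 𝓔∞ ≤ 𝓜 ≤ ⊤`
(items over `⊤` omit the vacuous membership hypothesis). -/
theorem schanuelOverSecondExpFieldsGlue_holds : SchanuelOverSecondExpFieldsGlue := by
  intro hT hL hD k m y z hy hz
  have h1 := relOn_trans (E'' := ⨆ n : ℕ, (fun E : Submodule ℚ ℂ => (E ⊔ Submodule.span ℚ (Complex.exp '' ↑E)) ⊔ Submodule.span ℚ (Complex.exp ⁻¹' ↑(E ⊔ Submodule.span ℚ (Complex.exp '' ↑E))))^[n + 1] (Submodule.span ℚ ({z : ℂ | IsAlgebraic ℚ z} ∪ {z : ℂ | ∃ β l : ℂ, IsAlgebraic ℚ β ∧ IsAlgebraic ℚ (Complex.exp l) ∧ z = β * l})))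
    secondExp_le_expTowerSup hT hL
  exact relOn_trans (E'' := ⊤) secondExp_le_elSpan h1
    (fun k m y z hy _ hz => hD k m y z hy hz) k m y z hy (fun _ => Submodule.mem_top) hz

end Summit.Schanuel.Schanuel.Theorems.RootDecomp1DSecondExpSplit

end
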